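import Summits.QuantumFields.YangMills.Theorems.BalabanUVNodesN09ChartReadAveragingSubmersion
import Summits.QuantumFields.YangMills.Theorems.BalabanUVNodesN09SelectorContinuousOfUniqueOrbit
import Mathlib.Analysis.Calculus.InverseFunctionTheorem.FDeriv

/-!
# NODE N09 [B12] — THE AVERAGING OF RECORD AND ITS k-FOLD ITERATE ARE OPEN AT EVERY SMALL CONFIGURATION; the openness input (O) of
# `…N09SelectorContinuousOfUniqueOrbit` DISCHARGED: `UkSel` ∕ `critCfgSelOfRecord` continuous from [B11] Thm 1 + N07's interiority + numerics only

Cell `pub-ymgap` (YM-PLAN Track A), seat `pub-ymgap-dag-n09-w1` g6 (D-0149 width seat 1 of node N09 [B12] = [Balaban1987RG1]); count-neutral helper of the K1-face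
(`--supports stmt-QuantumFields-27364 --as helper`).  [I] = [Balaban1987RG1] (CMP 109), [B7] = [Balaban1985Averaging] (CMP 98), [B11] = [Balaban1985Variational] (CMP 102).

WHY.  This seat's `…N09SelectorContinuousOfUniqueOrbit` (same generation) proves that node00-def-B's offered background selector `UkSel` — and with it the
critical configuration `critCfgSelOfRecord = Ū^k ∘ UkSel (k+1)` of [I] (2.3), whose continuity is the `hcrit` binder of the (F1) regularity tower
(`…N09RegularityTowerOfGeometricChartData`) — is continuous wherever (E) the open-class fibre is non-empty, (I) N07's closed-class minimisers are interior,
(U) [B11]'s minimal orbit is unique, and (O) THE AVERAGING OF RECORD IS OPEN AT THE MINIMISERS: `∀ O ∈ 𝓝 U₀, Ū^k '' O ∈ 𝓝[D] V`.  THIS FILE proves (O) outright,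
for every configuration of [B7]'s (52)-small class, from dag-n09-w4 g4∕g5's chart-read theorems (`…N09ChartReadAveragingSmooth` ∕ `…Submersion`): the (0.4) average
read in the bond-wise exponential charts, `ψ_{U₀}(A) = (c ↦ Λ(Ū(Θ^B(A)·U₀)(c)·Ū(U₀)(c)⁻¹))`, is `C^∞` at `0` with ONTO derivative (`fderiv_chartRead_avgFun_range_eq_top`, from
dag-n07-w2's onto central response) — so by the open-mapping half of the inverse function theorem for SUBMERSIONS (Mathlib `HasStrictFDerivAt.map_nhds_eq_of_surj`;
no injectivity, no one-bond structure) `ψ_{U₀}` maps neighbourhoods of `0` onto neighbourhoods of `0`, and the charts transport this to `Ū` itself.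

WHAT IS PROVED (theorems only, 0 `def`, 0 `sorry`).
§1 chart transport on `SU(N)^{bonds}` (p28's `HaarExponentialChart.IsChartRep` windows): `logChart_one` · `nhds_one_le_map_piExpChart` (the bond-wise chart `Θ^B : A ↦ (b ↦ Θ(A b))`
   maps neighbourhoods of `0` onto neighbourhoods of `1`: `Θ(B(0,s))^B` is an open box) · `nhds_le_map_piExpChart_mulRight` (… times a fixed configuration).
§2 ★★★ `nhds_le_map_avgFun_of_loopSmall` — ONE STEP, any torus `P`, level `j`, `j+1 ≤ m+K`: at every `U₀` of the loop α-guard (`∀ c i, |U₀(loop) − 1| ≤ α`, `α ≤ 1∕24`,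
   `α < δ_N`, `157·α < L^{1−d}` — dag-n09-w4's hypotheses verbatim) `𝓝 (Ū U₀) ≤ map Ū (𝓝 U₀)`; `image_mem_nhds_avgFun_of_loopSmall` (`O ∈ 𝓝 U₀ ⇒ Ū '' O ∈ 𝓝 (Ū U₀)`).
§3 ★★★ `nhds_le_map_iter_avOfRecord_of_plaqSmall` — k-FOLD at NODE 00's objects: `PlaqSmall (α₀η_k²) U`, `α₀` admissible as in (53) plus the two loop-guard numerics on
   `2α₀` ⟹ `∀ i ≤ k, 𝓝 (Ū^i U) ≤ map Ū^i (𝓝 U)` (induction; every intermediate average is `2α₀`-small — [B7] Prop. 2, n21-c ∕ N07 `plaqSmall_two_iter_avOfRecord` — hence in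
   the loop guard, `LatticeWordStokes.dist1_loopHol_le` + N07 `loopRadius_lt_deltaSU`).
§4 ★★★ `hopen_of_plaqSmall` — the (O) binder of `…N09SelectorContinuousOfUniqueOrbit` at every (0.21) minimiser over the class `bgReg e`, `e < α₀`, for ANY `D`;
   ★★★ `continuousOn_UkSel_of_uniqueOrbit'` · ★★★ `continuousOn_critCfgSelOfRecord_of_uniqueOrbit'` · ★★ `hcritSel_domAlt_of_uniqueOrbit'` — the selector ∕ critical-configuration
   continuity and the tower's `hcrit` (Sel edition) from (E) (I) (U) + NUMERICS ONLY.

HONEST FRAMING.  Count-neutral kernel calculus ∕ topology on the tree's OWN (0.4) averaging, read through dag-n09-w4's landed chart-read theorems BY NAME; NOTHING of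
Bałaban's asserted; [B11] Thm 1 ((E) solvability in the open class, (U) uniqueness) and N07's interiority sentence (I) stay DISPLAYED; the numerics are displayed
smallness conditions on `α₀` («ε₀ sufficiently small»), not optimised; NO carrier re-pointed (the record's `critCfgOfRecord` still reads the bare `Uk`); `hreg` ∕ N09 NOT
discharged; conjunct 1 (Lemma 4) ∕ FLAG №7 untouched; K0⁷ ∕ K1⁹ ∕ K3⁸ NOT closed; counts unmoved (typed 28∕28 · discharged 5∕28); one finite four-torus programme at fixed
`ε = L^{−K}` per run — R4 closes the conditional rung `BalabanLadder.UV` only; NOT ℝ⁴ ∕ infinite volume ∕ OS; the Yang–Mills mass gap (Clay) is NOT proved by any of this.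
-/

noncomputable section

open scoped Matrix.Norms.L2Operator Topology
open Set Filter Function

namespace Summit.QuantumFields.YangMills.BalabanUVNodes.N09AveragingOpenAtSmallFields

open Literature.MathematicalPhysics.QuantumFieldTheory.Balaban1983to89
open Literature.MathematicalPhysics.QuantumFieldTheory.Balaban1983to89.T4Continuum (T4Family)
open Literature.MathematicalPhysics.QuantumFieldTheory.Balaban1983to89.HaarExponentialChart
open Literature.MathematicalPhysics.QuantumFieldTheory.Balaban1983to89.HaarExponentialChart.IsChartRep
open Literature.MathematicalPhysics.QuantumFieldTheory.Balaban1983to89.BlockAveraging (Small Idx avgFun loopHol)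
open Literature.MathematicalPhysics.QuantumFieldTheory.Balaban1983to89.ExpMeanLog (expMeanLogSU deltaSU)
open Literature.MathematicalPhysics.QuantumFieldTheory.Balaban1983to89.Node00
open Literature.MathematicalPhysics.QuantumLattice (fundamentalRep)
open Summit.QuantumFields.YangMills.BalabanUVNodes.N09ChartReadAveragingSmooth (contDiffAt_chartRead_avgFun continuousAt_avgFun_of_small piExpChart_translate_zero)
open Summit.QuantumFields.YangMills.BalabanUVNodes.N09ChartReadAveragingSubmersion (fderiv_chartRead_avgFun_range_eq_top)
open Summit.QuantumFields.YangMills.BalabanUVNodes.N07DirectMethod (plaqSmall_two_iter_avOfRecord loopRadius_lt_deltaSU)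
open Summit.QuantumFields.YangMills.BalabanUVNodes.N09SelectorContinuousOfUniqueOrbit
  (continuousWithinAt_UkSel_of_uniqueOrbit continuousOn_critCfgSelOfRecord_of_uniqueOrbit)

/-! ## §1 Chart transport on `SU(N)^{bonds}`: the bond-wise exponential chart is open at `0` -/

section Charts

variable {N : ℕ} [NeZero N] {ι : Type*} [Fintype ι]

/-- `Λ 1 = 0` for the exponential chart of `SU(N)` (`Λ(Θ 0) = 0`, `Θ 0 = 1`). [cite: Helgason2000, Ch. I §1 Thm. 1.14 (13) p. 96 (bookkeeping)] -/
theorem logChart_one : (isChartRep_specialUnitaryGroup (n := Fin N)).logChart (1 : SU N) = 0 := by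
  have h := (isChartRep_specialUnitaryGroup (n := Fin N)).logChart_expChart (X := (0 : (specialUnitaryLogChart (Fin N)).lie))
    (by rw [norm_zero]; exact chartRadius_pos)
  rwa [(isChartRep_specialUnitaryGroup (n := Fin N)).expChart_zero] at h

/-- ★ **The bond-wise exponential chart `Θ^B : A ↦ (b ↦ Θ(A b))` is OPEN AT `0`**: every neighbourhood of `0` in `𝔰𝔲(N)^B` is mapped onto a neighbourhood of `1` in
`SU(N)^B` — it contains a sup-norm ball `B(0, s)`, `s ≤ s_C`, whose image is the open box `∏_b Θ(B(0, s))` (p28 `isOpen_window`, `one_mem_window`).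
[cite: Helgason2000, Ch. I §1 Thm. 1.14 (13) p. 96] -/
theorem nhds_one_le_map_piExpChart :
    𝓝 (1 : ι → SU N) ≤ map (fun A : ι → (specialUnitaryLogChart (Fin N)).lie => fun b => (isChartRep_specialUnitaryGroup (n := Fin N)).expChart (A b)) (𝓝 0) := by
  set h := isChartRep_specialUnitaryGroup (n := Fin N) with hh
  refine Filter.le_map fun O hO => ?_
  obtain ⟨ε, hε, hεO⟩ := Metric.mem_nhds_iff.1 hO
  set s : ℝ := min ε (chartRadius (specialUnitaryLogChart (Fin N))) with hs
  have hs0 : 0 < s := lt_min hε chartRadius_pos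
  have hsC : s ≤ chartRadius (specialUnitaryLogChart (Fin N)) := min_le_right _ _
  have hsε : s ≤ ε := min_le_left _ _
  -- the open box `∏_b window s` is a neighbourhood of `1` contained in the image
  have hbox : {W : ι → SU N | ∀ b, W b ∈ h.window s} ∈ 𝓝 (1 : ι → SU N) := by
    have hopen : IsOpen {W : ι → SU N | ∀ b, W b ∈ h.window s} := by
      rw [setOf_forall]
      exact isOpen_iInter_of_finite fun b => (h.isOpen_window hsC).preimage (continuous_apply b)
    exact hopen.mem_nhds fun b => h.one_mem_window hs0
  refine mem_of_superset hbox fun W hW => ?_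
  choose A hA using fun b => hW b
  refine ⟨A, hεO ?_, funext fun b => (hA b).2⟩
  rw [mem_ball_zero_iff, pi_norm_lt_iff hε]
  exact fun b => (mem_ball_zero_iff.1 (hA b).1).trans_le hsε

/-- **… times a fixed configuration**: `A ↦ (b ↦ Θ(A b)·g₀ b)` maps every neighbourhood of `0` onto a neighbourhood of `g₀` (right translation is a homeomorphism of
`SU(N)^B`). [cite: Helgason2000, Ch. I §1 Thm. 1.14 (13) p. 96 (bookkeeping)] -/
theorem nhds_le_map_piExpChart_mulRight (g₀ : ι → SU N) :
    𝓝 g₀ ≤ map (fun A : ι → (specialUnitaryLogChart (Fin N)).lie => fun b => (isChartRep_specialUnitaryGroup (n := Fin N)).expChart (A b) * g₀ b) (𝓝 0) := by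
  have hR : map (fun W : ι → SU N => W * g₀) (𝓝 1) = 𝓝 g₀ := by
    have h1 := (Homeomorph.mulRight g₀).map_nhds_eq (1 : ι → SU N)
    simp only [Homeomorph.coe_mulRight, one_mul] at h1
    exact h1
  have hcomp : (fun A : ι → (specialUnitaryLogChart (Fin N)).lie => fun b => (isChartRep_specialUnitaryGroup (n := Fin N)).expChart (A b) * g₀ b)
      = (fun W : ι → SU N => W * g₀) ∘ (fun A : ι → (specialUnitaryLogChart (Fin N)).lie => fun b => (isChartRep_specialUnitaryGroup (n := Fin N)).expChart (A b)) := by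
    funext A; rfl
  rw [hcomp, ← Filter.map_map, ← hR]
  exact Filter.map_mono nhds_one_le_map_piExpChart

end Charts

/-! ## §2 One step: the (0.4) averaging is open at every configuration of the loop guard -/

section OneStep

variable {P : Params} {j : ℕ} {N : ℕ} [NeZero N]

/-- ★★★ **THE (0.4) AVERAGING IS OPEN AT EVERY GUARDED CONFIGURATION.**  For `U₀` in the standing range `j + 1 ≤ m + K` with every loop variable within `α` of `1`
(`α ≤ 1∕24`, `α < δ_N`, `157·α < L^{1−d}`): `𝓝 (Ū U₀) ≤ map Ū (𝓝 U₀)` for `Ū = avgFun expMeanLogSU` — every neighbourhood of `U₀` averages onto a neighbourhood of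
`Ū U₀`.  The chart read `ψ_{U₀}` (dag-n09-w4: `C^∞` at `0`, onto derivative) is open at `0` by `HasStrictFDerivAt.map_nhds_eq_of_surj`; the in-chart `A ↦ Θ^B(A)·U₀` is
continuous with value `U₀` at `0`; the out-chart `W ↦ (c ↦ Λ(W c·Ū(U₀)(c)⁻¹))` is undone near `Ū U₀` by `E : A ↦ Θ^B(A)·Ū(U₀)` (`expChart_logChart`), which is open at
`0` (§1). [cite: Balaban1987RG1, (0.4), (0.8) p.253; Balaban1985Averaging, Prop. 3 (122)–(124) p.36] -/
theorem nhds_le_map_avgFun_of_loopSmall {U₀ : GaugeField P j (SU N)} (hj : j + 1 ≤ P.m + P.K) {α : ℝ}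
    (hα : ∀ c i, dist1 (loopHol U₀ c i) ≤ α) (hα24 : α ≤ 1 / 24) (hαδ : α < deltaSU (Fin N)) (hαL : 157 * α < ((P.L : ℝ) ^ (P.d - 1))⁻¹) :
    𝓝 (avgFun (expMeanLogSU (n := Fin N)) U₀) ≤ map (avgFun (expMeanLogSU (n := Fin N))) (𝓝 U₀) := by
  set h := isChartRep_specialUnitaryGroup (n := Fin N) with hh
  set avg : GaugeField P j (SU N) → GaugeField P (j + 1) (SU N) := avgFun (expMeanLogSU (n := Fin N)) with havg
  set g₀ : GaugeField P (j + 1) (SU N) := avg U₀ with hg₀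
  set Λin : (PBond P j → (specialUnitaryLogChart (Fin N)).lie) → GaugeField P j (SU N) := fun A b => h.expChart (A b) * U₀ b with hΛin
  set Λout : GaugeField P (j + 1) (SU N) → (PBond P (j + 1) → (specialUnitaryLogChart (Fin N)).lie) :=
    fun W c => h.logChart (W c * (g₀ c)⁻¹) with hΛout
  set E : (PBond P (j + 1) → (specialUnitaryLogChart (Fin N)).lie) → GaugeField P (j + 1) (SU N) := fun A c => h.expChart (A c) * g₀ c with hE
  set ψ : (PBond P j → (specialUnitaryLogChart (Fin N)).lie) → (PBond P (j + 1) → (specialUnitaryLogChart (Fin N)).lie) :=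
    fun A c => h.logChart (avg (fun b => h.expChart (A b) * U₀ b) c * (avg U₀ c)⁻¹) with hψ
  have hsmall : ∀ c, Small (expMeanLogSU (n := Fin N)) U₀ c := fun c i => lt_of_le_of_lt (hα c i) hαδ
  haveI : CompleteSpace (specialUnitaryLogChart (Fin N)).lie := FiniteDimensional.complete ℝ _
  -- Step A: the chart read is open at `0` (onto derivative)
  have hA : map ψ (𝓝 0) = 𝓝 (ψ 0) := by
    have hstrict : HasStrictFDerivAt ψ (fderiv ℝ ψ 0) 0 :=
      (contDiffAt_chartRead_avgFun (P := P) (j := j) U₀ hsmall).hasStrictFDerivAt (by simp)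
    exact HasStrictFDerivAt.map_nhds_eq_of_surj (f' := fderiv ℝ ψ 0) hstrict
      (fderiv_chartRead_avgFun_range_eq_top (P := P) (j := j) hj hα hα24 hαδ hαL)
  -- `ψ 0 = 0`
  have hψ0 : ψ 0 = 0 := by
    funext c
    show h.logChart (avg (fun b => h.expChart ((0 : PBond P j → (specialUnitaryLogChart (Fin N)).lie) b) * U₀ b) c * (avg U₀ c)⁻¹) = 0
    rw [piExpChart_translate_zero, mul_inv_cancel, logChart_one]
  -- Step B: `ψ = Λout ∘ avg ∘ Λin` and `Λin` is continuous with `Λin 0 = U₀`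
  have hψeq : ψ = Λout ∘ avg ∘ Λin := rfl
  have hΛin_cont : Continuous Λin :=
    continuous_pi fun b => (h.continuous_expChart.comp (continuous_apply b)).mul continuous_const
  have hΛin0 : Λin 0 = U₀ := piExpChart_translate_zero (P := P) (j := j) U₀
  have hB : map ψ (𝓝 0) ≤ map Λout (map avg (𝓝 U₀)) := by
    rw [hψeq, ← Filter.map_map, ← Filter.map_map]
    refine Filter.map_mono (Filter.map_mono ?_)
    have := hΛin_cont.tendsto (0 : PBond P j → (specialUnitaryLogChart (Fin N)).lie)
    rwa [hΛin0] at this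
  -- Step C: `E ∘ Λout = id` eventually along `map avg (𝓝 U₀)` (the out-chart is undone on p28's window)
  have hcont_avg : ContinuousAt avg U₀ := continuousAt_avgFun_of_small (P := P) (j := j) U₀ hsmall
  have hev : ∀ᶠ U in 𝓝 U₀, ∀ c, ‖fundamentalRep (Fin N) (avg U c * (g₀ c)⁻¹) - 1‖ < innerRadius (specialUnitaryLogChart (Fin N)) := by
    refine eventually_all.2 fun c => ?_
    have hf : ContinuousAt (fun U : GaugeField P j (SU N) => fundamentalRep (Fin N) (avg U c * (g₀ c)⁻¹)) U₀ :=
      h.continuous.continuousAt.comp (((continuous_apply c).continuousAt.comp hcont_avg).mul continuousAt_const)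
    have hF : ContinuousAt (fun U : GaugeField P j (SU N) => ‖fundamentalRep (Fin N) (avg U c * (g₀ c)⁻¹) - 1‖) U₀ :=
      (hf.sub continuousAt_const).norm
    have h0 : ‖fundamentalRep (Fin N) (avg U₀ c * (g₀ c)⁻¹) - 1‖ < innerRadius (specialUnitaryLogChart (Fin N)) := by
      rw [hg₀, mul_inv_cancel, map_one, sub_self, norm_zero]
      exact innerRadius_pos
    exact hF.eventually_lt continuousAt_const h0
  have hC : map E (map Λout (map avg (𝓝 U₀))) = map avg (𝓝 U₀) := by
    rw [Filter.map_map]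
    conv_rhs => rw [← Filter.map_id (f := map avg (𝓝 U₀))]
    refine Filter.map_congr ?_
    rw [EventuallyEq, Filter.eventually_map]
    filter_upwards [hev] with U hU
    funext c
    show h.expChart (h.logChart (avg U c * (g₀ c)⁻¹)) * g₀ c = avg U c
    rw [h.expChart_logChart (hU c), inv_mul_cancel_right]
  -- Step D + assembly: `E` is open at `0 = ψ 0`
  calc 𝓝 (avg U₀) = 𝓝 g₀ := rfl
    _ ≤ map E (𝓝 0) := nhds_le_map_piExpChart_mulRight g₀
    _ = map E (map ψ (𝓝 0)) := by rw [hA, hψ0]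
    _ ≤ map E (map Λout (map avg (𝓝 U₀))) := Filter.map_mono hB
    _ = map avg (𝓝 U₀) := hC

/-- The same, as the openness clause consumers read: every neighbourhood of a guarded `U₀` averages onto a neighbourhood of `Ū U₀`.
[cite: Balaban1987RG1, (0.4) p.253] -/
theorem image_mem_nhds_avgFun_of_loopSmall {U₀ : GaugeField P j (SU N)} (hj : j + 1 ≤ P.m + P.K) {α : ℝ}
    (hα : ∀ c i, dist1 (loopHol U₀ c i) ≤ α) (hα24 : α ≤ 1 / 24) (hαδ : α < deltaSU (Fin N)) (hαL : 157 * α < ((P.L : ℝ) ^ (P.d - 1))⁻¹)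
    {O : Set (GaugeField P j (SU N))} (hO : O ∈ 𝓝 U₀) :
    avgFun (expMeanLogSU (n := Fin N)) '' O ∈ 𝓝 (avgFun (expMeanLogSU (n := Fin N)) U₀) :=
  nhds_le_map_avgFun_of_loopSmall hj hα hα24 hαδ hαL (Filter.image_mem_map hO)

end OneStep

/-! ## §3 The k-fold average of record is open at every (52)-small configuration -/

section Iter

variable {F : T4Family} {N : ℕ} [NeZero N]

/-- The loop letters of a `2α₀`-small configuration are within `(((d+2)L)²∕4)·2α₀` of `1` (`LatticeWordStokes.dist1_loopHol_le`).
[cite: Balaban1987RG1, (0.4) p.253 (bookkeeping)] -/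
theorem loopSmall_of_plaqSmall_two (K i : ℕ) {α₀ : ℝ} (hα : 0 < α₀) {U : GaugeField (F.P K) i (SU N)} (hU : PlaqSmall (2 * α₀) U) :
    ∀ c idx, dist1 (loopHol U c idx) ≤ ((((F.P K).d + 2) * (F.P K).L : ℕ) : ℝ) ^ 2 / 4 * (2 * α₀) :=
  fun c idx => LatticeWordStokes.dist1_loopHol_le (le_of_lt (by positivity)) hU c idx

/-- ★★★ **THE k-FOLD AVERAGE OF RECORD IS OPEN AT EVERY (52)-SMALL CONFIGURATION**: `PlaqSmall (α₀η_k²) U` with `α₀` admissible as in (53) (`0 < α₀`,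
`C₀(d)α₀ ≤ ⅓`, `2α₀ ≤ c′₂`) plus the loop-guard numerics on `2α₀` (`(((d+2)L)²∕4)·2α₀ ≤ 1∕24`, `157·(((d+2)L)²∕4)·2α₀ < L^{1−d}`), `k ≤ m + K` ⟹ for every `i ≤ k`,
`𝓝 (Ū^i U) ≤ map Ū^i (𝓝 U)`.  Induction on `i`: every intermediate average is `2α₀`-small ([B7] Prop. 2, N07 `plaqSmall_two_iter_avOfRecord`), hence in the loop guard, where
§2 applies. [cite: Balaban1985Averaging, Prop. 2 (52)–(54) p.26; Balaban1987RG1, (0.4) p.253] -/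
theorem nhds_le_map_iter_avOfRecord_of_plaqSmall (K k : ℕ) {α₀ : ℝ} (hα : 0 < α₀)
    (hα3 : (143 * (((((F.P K).d + 4 : ℕ) : ℝ)) ^ 2 / 4) ^ 2) * α₀ ≤ 1 / 3)
    (hα2 : 2 * α₀ ≤ 2 * deltaSU (Fin N) / ((((F.P K).d + 4) * (F.P K).L : ℕ) : ℝ) ^ 2)
    (hα24 : ((((F.P K).d + 2) * (F.P K).L : ℕ) : ℝ) ^ 2 / 4 * (2 * α₀) ≤ 1 / 24)
    (hαL : 157 * (((((F.P K).d + 2) * (F.P K).L : ℕ) : ℝ) ^ 2 / 4 * (2 * α₀)) < (((F.P K).L : ℝ) ^ ((F.P K).d - 1))⁻¹)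
    (hk : k ≤ (F.P K).m + (F.P K).K)
    {U : GaugeField (F.P K) 0 (SU N)} (h52 : PlaqSmall (α₀ * (F.P K).eta k ^ 2) U) :
    ∀ i : ℕ, i ≤ k → 𝓝 (Averaging.iter (avOfRecord F N K) i U) ≤ map (Averaging.iter (avOfRecord F N K) i) (𝓝 U)
  | 0, _ => by
    show 𝓝 U ≤ map (fun x => x) (𝓝 U)
    rw [Filter.map_id']
  | i + 1, hi => by
    have hi' : i ≤ k := Nat.le_of_succ_le hi
    have ih := nhds_le_map_iter_avOfRecord_of_plaqSmall K k hα hα3 hα2 hα24 hαL hk h52 i hi'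
    have hsm : PlaqSmall (2 * α₀) (Averaging.iter (avOfRecord F N K) i U) := plaqSmall_two_iter_avOfRecord K k hα hα3 hα2 h52 hi'
    have hstep : 𝓝 (avgFun (expMeanLogSU (n := Fin N)) (Averaging.iter (avOfRecord F N K) i U))
        ≤ map (avgFun (expMeanLogSU (n := Fin N))) (𝓝 (Averaging.iter (avOfRecord F N K) i U)) :=
      nhds_le_map_avgFun_of_loopSmall (P := F.P K) (j := i) (by omega) (loopSmall_of_plaqSmall_two K i hα hsm) hα24
        (loopRadius_lt_deltaSU K hα hα2) hαL
    show 𝓝 ((avgFun (expMeanLogSU (n := Fin N))) (Averaging.iter (avOfRecord F N K) i U)) ≤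
      map ((avgFun (expMeanLogSU (n := Fin N))) ∘ Averaging.iter (avOfRecord F N K) i) (𝓝 U)
    rw [← Filter.map_map]
    exact hstep.trans (Filter.map_mono ih)

/-- Consumer form: every neighbourhood of a (52)-small `U` is carried by `Ū^k` onto a neighbourhood of `Ū^k U`. [cite: Balaban1985Averaging, Prop. 2 (52)–(54) p.26] -/
theorem image_mem_nhds_iter_avOfRecord_of_plaqSmall (K k : ℕ) {α₀ : ℝ} (hα : 0 < α₀)
    (hα3 : (143 * (((((F.P K).d + 4 : ℕ) : ℝ)) ^ 2 / 4) ^ 2) * α₀ ≤ 1 / 3)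
    (hα2 : 2 * α₀ ≤ 2 * deltaSU (Fin N) / ((((F.P K).d + 4) * (F.P K).L : ℕ) : ℝ) ^ 2)
    (hα24 : ((((F.P K).d + 2) * (F.P K).L : ℕ) : ℝ) ^ 2 / 4 * (2 * α₀) ≤ 1 / 24)
    (hαL : 157 * (((((F.P K).d + 2) * (F.P K).L : ℕ) : ℝ) ^ 2 / 4 * (2 * α₀)) < (((F.P K).L : ℝ) ^ ((F.P K).d - 1))⁻¹)
    (hk : k ≤ (F.P K).m + (F.P K).K)
    {U : GaugeField (F.P K) 0 (SU N)} (h52 : PlaqSmall (α₀ * (F.P K).eta k ^ 2) U) {O : Set (GaugeField (F.P K) 0 (SU N))} (hO : O ∈ 𝓝 U) :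
    Averaging.iter (avOfRecord F N K) k '' O ∈ 𝓝 (Averaging.iter (avOfRecord F N K) k U) :=
  nhds_le_map_iter_avOfRecord_of_plaqSmall K k hα hα3 hα2 hα24 hαL hk h52 k le_rfl (Filter.image_mem_map hO)

end Iter

/-! ## §4 (O) discharged: the selector, the critical configuration and the tower's `hcrit` (Sel edition) from (E)(I)(U) + numerics -/

section Discharge

variable {F : T4Family} {N : ℕ} [NeZero N]

/-- ★★★ **THE (O) BINDER OF `…N09SelectorContinuousOfUniqueOrbit` IS A THEOREM**: at every (0.21) minimiser `U₀` over `V` in the class `bgReg e`, `e < α₀` (`α₀` as in §3),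
every neighbourhood `O` of `U₀` has `Ū^k '' O ∈ 𝓝[D] V`, for ANY `D` (indeed `∈ 𝓝 V`). [cite: Balaban1987RG1, (0.21) p.256, (0.4) p.253; Balaban1985Averaging, Prop. 2 p.26] -/
theorem hopen_of_plaqSmall (K k : ℕ) {e α₀ : ℝ} (he : e < α₀) (hα : 0 < α₀)
    (hα3 : (143 * (((((F.P K).d + 4 : ℕ) : ℝ)) ^ 2 / 4) ^ 2) * α₀ ≤ 1 / 3)
    (hα2 : 2 * α₀ ≤ 2 * deltaSU (Fin N) / ((((F.P K).d + 4) * (F.P K).L : ℕ) : ℝ) ^ 2)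
    (hα24 : ((((F.P K).d + 2) * (F.P K).L : ℕ) : ℝ) ^ 2 / 4 * (2 * α₀) ≤ 1 / 24)
    (hαL : 157 * (((((F.P K).d + 2) * (F.P K).L : ℕ) : ℝ) ^ 2 / 4 * (2 * α₀)) < (((F.P K).L : ℝ) ^ ((F.P K).d - 1))⁻¹)
    (hk : k ≤ (F.P K).m + (F.P K).K) (D : Set (GaugeField (F.P K) k (SU N)))
    {V : GaugeField (F.P K) k (SU N)} {U₀ : GaugeField (F.P K) 0 (SU N)} (h₀ : IsBackground (avOfRecord F N K) (bgReg F N K k e) k V U₀) :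
    ∀ O ∈ 𝓝 U₀, Averaging.iter (avOfRecord F N K) k '' O ∈ 𝓝[D] V := by
  intro O hO
  have hη : 0 < (F.P K).eta k ^ 2 := pow_pos (pow_pos (inv_pos.mpr (Nat.cast_pos.mpr (F.P K).L_pos)) k) 2
  have h52 : PlaqSmall (α₀ * (F.P K).eta k ^ 2) U₀ :=
    fun p => ((mem_bgReg_iff F N K k e U₀).1 h₀.2.1 p).trans (mul_lt_mul_of_pos_right he hη)
  have hmem := image_mem_nhds_iter_avOfRecord_of_plaqSmall K k hα hα3 hα2 hα24 hαL hk h52 hO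
  rw [h₀.1] at hmem
  exact mem_nhdsWithin_of_mem_nhds hmem

/-- ★★★ **THE OFFERED SELECTOR IS CONTINUOUS from (E) (I) (U) + numerics**: on every set `D` of coarse data where the open-class fibre is non-empty, N07's closed-class
minimisers are interior and [B11]'s minimal orbit is unique, `Node00.UkSel F N K k e` is continuous (`e < α₀`, `α₀` as in §3, `k ≤ m + K`).
[cite: Balaban1985Variational, Thm 1 p.279 and (181) p.307; Balaban1987RG1, (0.21) p.256] -/
theorem continuousOn_UkSel_of_uniqueOrbit' (K k : ℕ) {e α₀ : ℝ} (he : e < α₀) (hα : 0 < α₀)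
    (hα3 : (143 * (((((F.P K).d + 4 : ℕ) : ℝ)) ^ 2 / 4) ^ 2) * α₀ ≤ 1 / 3)
    (hα2 : 2 * α₀ ≤ 2 * deltaSU (Fin N) / ((((F.P K).d + 4) * (F.P K).L : ℕ) : ℝ) ^ 2)
    (hα24 : ((((F.P K).d + 2) * (F.P K).L : ℕ) : ℝ) ^ 2 / 4 * (2 * α₀) ≤ 1 / 24)
    (hαL : 157 * (((((F.P K).d + 2) * (F.P K).L : ℕ) : ℝ) ^ 2 / 4 * (2 * α₀)) < (((F.P K).L : ℝ) ^ ((F.P K).d - 1))⁻¹)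
    (hk : k ≤ (F.P K).m + (F.P K).K) {D : Set (GaugeField (F.P K) k (SU N))}
    (hne : ∀ V ∈ D, ∃ U ∈ bgReg F N K k e, Averaging.iter (avOfRecord F N K) k U = V)
    (hint : ∀ V ∈ D, ∀ U₀ : GaugeField (F.P K) 0 (SU N),
      IsBackground (avOfRecord F N K) (closure (bgReg F N K k e)) k V U₀ → U₀ ∈ bgReg F N K k e)
    (huniq : ∀ V ∈ D, UniqueUkOrbit F N K k e V) :
    ContinuousOn (UkSel F N K k e) D :=
  fun _ hV₀ => continuousWithinAt_UkSel_of_uniqueOrbit K k he hα hα3 hα2 hk hV₀ hne hint huniq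
    (fun _ h₀ => hopen_of_plaqSmall K k he hα hα3 hα2 hα24 hαL hk D h₀)

/-- ★★★ **THE CRITICAL CONFIGURATION (Sel edition) IS CONTINUOUS from (E) (I) (U) + numerics** on every set `D` of level-`(k+1)` data (radius `ν.εreg < α₀`).
[cite: Balaban1987RG1, (2.3) p.265; Balaban1985Averaging, Prop. 2 (52)–(54) p.26; Balaban1985Variational, Thm 1 p.279] -/
theorem continuousOn_critCfgSelOfRecord_of_uniqueOrbit' (ν : Stage7Numerics) (K k : ℕ) {α₀ : ℝ} (he : ν.εreg < α₀) (hα : 0 < α₀)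
    (hα3 : (143 * (((((F.P K).d + 4 : ℕ) : ℝ)) ^ 2 / 4) ^ 2) * α₀ ≤ 1 / 3)
    (hα2 : 2 * α₀ ≤ 2 * deltaSU (Fin N) / ((((F.P K).d + 4) * (F.P K).L : ℕ) : ℝ) ^ 2)
    (hα24 : ((((F.P K).d + 2) * (F.P K).L : ℕ) : ℝ) ^ 2 / 4 * (2 * α₀) ≤ 1 / 24)
    (hαL : 157 * (((((F.P K).d + 2) * (F.P K).L : ℕ) : ℝ) ^ 2 / 4 * (2 * α₀)) < (((F.P K).L : ℝ) ^ ((F.P K).d - 1))⁻¹)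
    (hk : k + 1 ≤ (F.P K).m + (F.P K).K) {D : Set (GaugeField (F.P K) (k + 1) (SU N))}
    (hne : ∀ W ∈ D, ∃ U ∈ bgReg F N K (k + 1) ν.εreg, Averaging.iter (avOfRecord F N K) (k + 1) U = W)
    (hint : ∀ W ∈ D, ∀ U₀ : GaugeField (F.P K) 0 (SU N),
      IsBackground (avOfRecord F N K) (closure (bgReg F N K (k + 1) ν.εreg)) (k + 1) W U₀ → U₀ ∈ bgReg F N K (k + 1) ν.εreg)
    (huniq : ∀ W ∈ D, UniqueUkOrbit F N K (k + 1) ν.εreg W) :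
    ContinuousOn (critCfgSelOfRecord F N ν K k) D :=
  continuousOn_critCfgSelOfRecord_of_uniqueOrbit ν K k he hα hα3 hα2 hk hne hint huniq
    (fun _ _ _ h₀ => hopen_of_plaqSmall K (k + 1) he hα hα3 hα2 hα24 hαL hk D h₀)

/-- ★★ **THE TOWER'S `hcrit`, Sel EDITION, from (E) (I) (U) + numerics**: `∀ j < K, ContinuousOn (critCfgSelOfRecord F N ν K j) (domAltOfRecord F N ν K (j+1))` — the binder of
`…N09RegularityTowerOfGeometricChartData.continuousOn_effActionHT_all_of_geometricChartData` with `critCfgOfRecord ↦ critCfgSelOfRecord` — provided the small-field domains carry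
[B11] Thm 1's solvability in the open class and uniqueness, and N07's interiority, at radius `ν.εreg < α₀` (`α₀` as in §3).
[cite: Balaban1987RG1, (2.3) p.265 and p.259; Balaban1985Variational, Thm 1 p.279] -/
theorem hcritSel_domAlt_of_uniqueOrbit' (ν : Stage7Numerics) (K : ℕ) {α₀ : ℝ} (he : ν.εreg < α₀) (hα : 0 < α₀)
    (hα3 : (143 * (((((F.P K).d + 4 : ℕ) : ℝ)) ^ 2 / 4) ^ 2) * α₀ ≤ 1 / 3)
    (hα2 : 2 * α₀ ≤ 2 * deltaSU (Fin N) / ((((F.P K).d + 4) * (F.P K).L : ℕ) : ℝ) ^ 2)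
    (hα24 : ((((F.P K).d + 2) * (F.P K).L : ℕ) : ℝ) ^ 2 / 4 * (2 * α₀) ≤ 1 / 24)
    (hαL : 157 * (((((F.P K).d + 2) * (F.P K).L : ℕ) : ℝ) ^ 2 / 4 * (2 * α₀)) < (((F.P K).L : ℝ) ^ ((F.P K).d - 1))⁻¹)
    (hne : ∀ j < K, ∀ W ∈ domAltOfRecord F N ν K (j + 1), ∃ U ∈ bgReg F N K (j + 1) ν.εreg, Averaging.iter (avOfRecord F N K) (j + 1) U = W)
    (hint : ∀ j < K, ∀ W ∈ domAltOfRecord F N ν K (j + 1), ∀ U₀ : GaugeField (F.P K) 0 (SU N),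
      IsBackground (avOfRecord F N K) (closure (bgReg F N K (j + 1) ν.εreg)) (j + 1) W U₀ → U₀ ∈ bgReg F N K (j + 1) ν.εreg)
    (huniq : ∀ j < K, ∀ W ∈ domAltOfRecord F N ν K (j + 1), UniqueUkOrbit F N K (j + 1) ν.εreg W) :
    ∀ j < K, ContinuousOn (critCfgSelOfRecord F N ν K j) (domAltOfRecord F N ν K (j + 1)) := by
  intro j hj
  have hk : j + 1 ≤ (F.P K).m + (F.P K).K := by
    rw [T4Family.P_K]
    have := (F.P K).m
    omega
  exact continuousOn_critCfgSelOfRecord_of_uniqueOrbit' ν K j he hα hα3 hα2 hα24 hαL hk (hne j hj) (hint j hj) (huniq j hj)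

end Discharge

end Summit.QuantumFields.YangMills.BalabanUVNodes.N09AveragingOpenAtSmallFields

end
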